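import Literature.Geometry.Kaehler.KaehlerSymbolIdentityProofs
import HarnessLib

/-!
# The symbol of the `∂̄`-Laplacian is scalar: `σ_∂̄ σ_∂̄* + σ_∂̄* σ_∂̄ = -½ ‖ξ‖² · id` (Warner 6.34–6.35 for `Δ_∂̄`)

F. W. Warner, GTM 94 (1983), 6.34–6.35 prove the ellipticity of the Laplace–Beltrami operator by
showing that its symbol `(-1)^{np} ⋆ξ⋆ξ + (-1)^{n(p-1)} ξ⋆ξ⋆` is an isomorphism. For the
`∂̄`-Laplacian `Δ_∂̄ = ∂̄∂̄* + ∂̄*∂̄` of a Hermitian vector space (an oriented even-dimensional real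
inner product space `V` with a skew, square `-1` operator `J`) the symbol is even a *scalar*:
with `σ_∂̄(ξ) = ξ^{0,1} ∧ ·` (`zeta01`), `σ_∂(ξ) = ξ^{1,0} ∧ ·` (`zeta10`) and
`σ_∂̄*(ξ) = -⋆_ℂ (ξ^{1,0} ∧ ⋆_ℂ ·)`,

  `ξ^{0,1} ∧ ⋆_ℂ(ξ^{1,0} ∧ ⋆_ℂ γ) + ⋆_ℂ(ξ^{1,0} ∧ ⋆_ℂ(ξ^{0,1} ∧ γ)) = ½ ‖ξ♯‖² γ`

(`wedge_star_wedge_star_add`, with the degree-`0` and top-degree companions), by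
`⋆_ℂ(ζ ∧ ⋆_ℂ γ) = ι_{(Re ζ)♯} γ + i ι_{(Im ζ)♯} γ` in even dimension
(`cHodgeStar_wedgeOne_cHodgeStar` of `KaehlerSymbolIdentityProofs`), the canonical anticommutation
relation `ι_w (ζ ∧ η) + ζ ∧ ι_w η = ζ(w) η` (`curryLeft_wedgeOne`), and the computation
`ξ^{0,1}(u₁) + i ξ^{0,1}(u₂) = ½ ‖ξ♯‖²` for `u₁ = ½ ξ♯`, `u₂ = ½ J ξ♯` (`zeta01_dual_add`).

## References

* F. W. Warner, GTM 94 (1983), 6.34, 6.35. [WarnerGTM94]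
* C. Voisin, *Hodge Theory and Complex Algebraic Geometry I* (2002), §5.1, Lemma 6.6 (proof). [VoisinHodgeI2002]
-/

noncomputable section

open Module ContinuousAlternatingMap Function Complex
open Literature.LinearAlgebra.Alternating

namespace Literature.Geometry.Kaehler

/-! ### The complex covectors `ξ^{1,0}`, `ξ^{0,1}` of a real covector -/

section Covectors

variable {V : Type*} [NormedAddCommGroup V] [NormedSpace ℝ V]

/-- `ξ^{1,0} = ½ ξ - ½ i (ξ ∘ J)` (complex-linear for `J`). [cite: VoisinHodgeI2002, §2.3.1] -/
def zeta10 (J : V →L[ℝ] V) (ξ : V →L[ℝ] ℝ) : V →L[ℝ] ℂ :=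
  ofRealCLM.comp ((2⁻¹ : ℝ) • ξ) + Complex.I • ofRealCLM.comp (-((2⁻¹ : ℝ) • ξ.comp J))

/-- `ξ^{0,1} = ½ ξ + ½ i (ξ ∘ J)` (conjugate-linear for `J`). [cite: VoisinHodgeI2002, §2.3.1] -/
def zeta01 (J : V →L[ℝ] V) (ξ : V →L[ℝ] ℝ) : V →L[ℝ] ℂ :=
  ofRealCLM.comp ((2⁻¹ : ℝ) • ξ) + Complex.I • ofRealCLM.comp ((2⁻¹ : ℝ) • ξ.comp J)

/-- Values of `zeta10`. [folklore] -/
theorem zeta10_apply (J : V →L[ℝ] V) (ξ : V →L[ℝ] ℝ) (v : V) :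
    zeta10 J ξ v = ((2⁻¹ * ξ v : ℝ) : ℂ) + Complex.I * ((-(2⁻¹ * ξ (J v)) : ℝ) : ℂ) := rfl

/-- Values of `zeta01`. [folklore] -/
theorem zeta01_apply (J : V →L[ℝ] V) (ξ : V →L[ℝ] ℝ) (v : V) :
    zeta01 J ξ v = ((2⁻¹ * ξ v : ℝ) : ℂ) + Complex.I * ((2⁻¹ * ξ (J v) : ℝ) : ℂ) := rfl

/-- Real part of a covector `a + i b` with real `a`, `b`. [folklore] -/
theorem reCLM_comp_ofReal_add (a b : V →L[ℝ] ℝ) :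
    reCLM.comp (ofRealCLM.comp a + Complex.I • ofRealCLM.comp b) = a := by
  ext v; simp

/-- Imaginary part of a covector `a + i b` with real `a`, `b`. [folklore] -/
theorem imCLM_comp_ofReal_add (a b : V →L[ℝ] ℝ) :
    imCLM.comp (ofRealCLM.comp a + Complex.I • ofRealCLM.comp b) = b := by
  ext v; simp

/-- `Re ξ^{1,0} = ½ ξ`. [folklore] -/
theorem reCLM_comp_zeta10 (J : V →L[ℝ] V) (ξ : V →L[ℝ] ℝ) : reCLM.comp (zeta10 J ξ) = (2⁻¹ : ℝ) • ξ :=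
  reCLM_comp_ofReal_add _ _

/-- `Im ξ^{1,0} = -½ ξ∘J`. [folklore] -/
theorem imCLM_comp_zeta10 (J : V →L[ℝ] V) (ξ : V →L[ℝ] ℝ) :
    imCLM.comp (zeta10 J ξ) = -((2⁻¹ : ℝ) • ξ.comp J) :=
  imCLM_comp_ofReal_add _ _

end Covectors

/-! ### The dual vectors and the scalar -/

section Scalar

open scoped RealInnerProductSpace

variable {V : Type*} [NormedAddCommGroup V] [InnerProductSpace ℝ V] [CompleteSpace V]

omit [CompleteSpace V] in
/-- For a skew operator, `⟪v, J v⟫ = 0`. [folklore] -/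
theorem inner_J_self (J : V →L[ℝ] V) (hJ : ∀ u v, ⟪J u, v⟫ = -⟪u, J v⟫) (v : V) : ⟪v, J v⟫ = 0 := by
  have h := hJ v v
  rw [real_inner_comm] at h
  linarith

/-- `(ξ ∘ J)♯ = -J ξ♯` for a skew operator `J`. [folklore] -/
theorem toDual_symm_comp_J (J : V →L[ℝ] V) (hJ : ∀ u v, ⟪J u, v⟫ = -⟪u, J v⟫) (ξ : V →L[ℝ] ℝ) :
    (InnerProductSpace.toDual ℝ V).symm (ξ.comp J) = -J ((InnerProductSpace.toDual ℝ V).symm ξ) := by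
  apply (InnerProductSpace.toDual ℝ V).injective
  rw [LinearIsometryEquiv.apply_symm_apply]
  ext w
  rw [ContinuousLinearMap.comp_apply, InnerProductSpace.toDual_apply_apply, inner_neg_left, hJ, neg_neg,
    InnerProductSpace.toDual_symm_apply]

/-- **The scalar**: for `u₁ = (Re ξ^{1,0})♯ = ½ ξ♯` and `u₂ = (Im ξ^{1,0})♯ = ½ J ξ♯`,
`ξ^{0,1}(u₁) + i ξ^{0,1}(u₂) = ½ ‖ξ♯‖²` (`J` skew with `J² = -1`). [cite: WarnerGTM94, 6.35] -/
theorem zeta01_dual_add (J : V →L[ℝ] V) (hJ1 : ∀ v, J (J v) = -v) (hJ : ∀ u v, ⟪J u, v⟫ = -⟪u, J v⟫)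
    (ξ : V →L[ℝ] ℝ) :
    zeta01 J ξ ((InnerProductSpace.toDual ℝ V).symm (reCLM.comp (zeta10 J ξ))) +
        Complex.I * zeta01 J ξ ((InnerProductSpace.toDual ℝ V).symm (imCLM.comp (zeta10 J ξ))) =
      ((2⁻¹ * ‖(InnerProductSpace.toDual ℝ V).symm ξ‖ ^ 2 : ℝ) : ℂ) := by
  set s : V := (InnerProductSpace.toDual ℝ V).symm ξ with hs
  have hu₁ : (InnerProductSpace.toDual ℝ V).symm (reCLM.comp (zeta10 J ξ)) = (2⁻¹ : ℝ) • s := by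
    rw [reCLM_comp_zeta10, map_smul]
  have hu₂ : (InnerProductSpace.toDual ℝ V).symm (imCLM.comp (zeta10 J ξ)) = (2⁻¹ : ℝ) • J s := by
    rw [imCLM_comp_zeta10, map_neg, map_smul, toDual_symm_comp_J J hJ ξ, smul_neg, neg_neg]
  have hξ : ∀ w, ξ w = ⟪s, w⟫ := fun w ↦ (InnerProductSpace.toDual_symm_apply (𝕜 := ℝ)).symm
  have e1 : ξ s = ‖s‖ ^ 2 := by rw [hξ, real_inner_self_eq_norm_sq]
  have e2 : ξ (J s) = 0 := by rw [hξ, inner_J_self J hJ s]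
  have e3 : ξ (J (J s)) = -‖s‖ ^ 2 := by rw [hJ1, map_neg, e1]
  rw [hu₁, hu₂, zeta01_apply, zeta01_apply]
  simp only [map_smul, smul_eq_mul, e1, e2, e3, mul_zero, mul_neg]
  push_cast
  linear_combination (-(2⁻¹ * (2⁻¹ * (‖s‖ : ℂ) ^ 2))) * Complex.I_mul_I

end Scalar

/-! ### The operator identity -/

section Operator

open scoped RealInnerProductSpace

variable {V : Type*} [NormedAddCommGroup V] [InnerProductSpace ℝ V] [FiniteDimensional ℝ V]
  {n : ℕ} [Fact (finrank ℝ V = n)] (o : Orientation ℝ V (Fin n))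

/-- The complexified Hodge star `⋆_ℂ η = ⋆(Re η) ⊗ 1 + i (⋆(Im η) ⊗ 1)` (pointwise value of
`MForm.cHodgeStar`; the notation of `KaehlerSymbolIdentityProofs`). -/
local notation "⋆ℂ[" o ", " h "]" η:max =>
  ContinuousLinearMap.compContinuousAlternatingMap Complex.ofRealCLM
      (hodgeStar o h (ContinuousLinearMap.compContinuousAlternatingMap Complex.reCLM η)) +
    Complex.I • ContinuousLinearMap.compContinuousAlternatingMap Complex.ofRealCLM
      (hodgeStar o h (ContinuousLinearMap.compContinuousAlternatingMap Complex.imCLM η))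

/-- Complex-valued alternating forms of degree `> dim V` vanish. [cite: WarnerGTM94, 2.6 (b) (2)] -/
theorem continuousAlternatingMap_eq_zero_of_finrank_lt {d : ℕ} (γ : V [⋀^Fin d]→L[ℝ] ℂ) (hd : n < d) :
    γ = 0 := by
  ext v
  have hV : finrank ℝ V = n := Fact.out
  have hli : ¬ LinearIndependent ℝ v := by
    intro hli
    have := hli.fintype_card_le_finrank
    simp only [Fintype.card_fin, hV] at this
    omega
  simpa using γ.toAlternatingMap.map_linearDependent v hli

/-- **`σ_∂̄ σ_∂̄*' + σ_∂̄*' σ_∂̄` is the scalar `½ ‖ξ♯‖²`** (generic degree `k + 1 < n`), where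
`σ_∂̄*'(ξ) = ⋆_ℂ(ξ^{1,0} ∧ ⋆_ℂ ·) = -σ_∂̄*(ξ)`: for every complex `(k+1)`-form `γ`,
`ξ^{0,1} ∧ ⋆_ℂ(ξ^{1,0} ∧ ⋆_ℂ γ) + ⋆_ℂ(ξ^{1,0} ∧ ⋆_ℂ(ξ^{0,1} ∧ γ)) = ½ ‖ξ♯‖² γ` on an even-dimensional
oriented inner product space with a skew operator `J`, `J² = -1` (Warner 6.34 (3) / 6.35 made
explicit for `Δ_∂̄`; `cHodgeStar_wedgeOne_cHodgeStar` and the anticommutation relation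
`curryLeft_wedgeOne`). [cite: WarnerGTM94, 6.35] -/
theorem wedge_star_wedge_star_add (hn : Even n) (J : V →L[ℝ] V) (hJ1 : ∀ v, J (J v) = -v)
    (hJ : ∀ u v, ⟪J u, v⟫ = -⟪u, J v⟫) (ξ : V →L[ℝ] ℝ) {k m m' : ℕ}
    (h₁ : (k + 1) + m = n) (h₂ : (m + 1) + k = n) (h₃ : (k + 1 + 1) + m' = n) (h₄ : (m' + 1) + (k + 1) = n)
    (γ : V [⋀^Fin (k + 1)]→L[ℝ] ℂ) :
    wedgeOne (zeta01 J ξ) (⋆ℂ[o, h₂] (wedgeOne (zeta10 J ξ) (⋆ℂ[o, h₁] γ))) +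
        ⋆ℂ[o, h₄] (wedgeOne (zeta10 J ξ) (⋆ℂ[o, h₃] (wedgeOne (zeta01 J ξ) γ))) =
      ((2⁻¹ * ‖(InnerProductSpace.toDual ℝ V).symm ξ‖ ^ 2 : ℝ) : ℂ) • γ := by
  set u₁ : V := (InnerProductSpace.toDual ℝ V).symm (reCLM.comp (zeta10 J ξ)) with hu₁
  set u₂ : V := (InnerProductSpace.toDual ℝ V).symm (imCLM.comp (zeta10 J ξ)) with hu₂
  rw [cHodgeStar_wedgeOne_cHodgeStar o h₁ h₂ (zeta10 J ξ) γ,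
    cHodgeStar_wedgeOne_cHodgeStar o h₃ h₄ (zeta10 J ξ) (wedgeOne (zeta01 J ξ) γ),
    neg_one_pow_mul_eq_one_of_even h₁ hn, neg_one_pow_mul_eq_one_of_even h₃ hn, one_smul, one_smul,
    ← hu₁, ← hu₂, wedgeOne_add, wedgeOne_smul, curryLeft_wedgeOne, curryLeft_wedgeOne,
    ← zeta01_dual_add J hJ1 hJ, ← hu₁, ← hu₂]
  module

/-- **Degree `0`** (only `σ_∂̄*' σ_∂̄`): `⋆_ℂ(ξ^{1,0} ∧ ⋆_ℂ(ξ^{0,1} ∧ η)) = ½ ‖ξ♯‖² η` for a complex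
`0`-form `η`. [cite: WarnerGTM94, 6.35] -/
theorem star_wedge_star_wedge_zero (hn : Even n) (J : V →L[ℝ] V) (hJ1 : ∀ v, J (J v) = -v)
    (hJ : ∀ u v, ⟪J u, v⟫ = -⟪u, J v⟫) (ξ : V →L[ℝ] ℝ) {m' : ℕ}
    (h₃ : (0 + 1) + m' = n) (h₄ : (m' + 1) + 0 = n) (η : V [⋀^Fin 0]→L[ℝ] ℂ) :
    ⋆ℂ[o, h₄] (wedgeOne (zeta10 J ξ) (⋆ℂ[o, h₃] (wedgeOne (zeta01 J ξ) η))) =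
      ((2⁻¹ * ‖(InnerProductSpace.toDual ℝ V).symm ξ‖ ^ 2 : ℝ) : ℂ) • η := by
  set u₁ : V := (InnerProductSpace.toDual ℝ V).symm (reCLM.comp (zeta10 J ξ)) with hu₁
  set u₂ : V := (InnerProductSpace.toDual ℝ V).symm (imCLM.comp (zeta10 J ξ)) with hu₂
  rw [cHodgeStar_wedgeOne_cHodgeStar o h₃ h₄ (zeta10 J ξ) (wedgeOne (zeta01 J ξ) η),
    neg_one_pow_mul_eq_one_of_even h₃ hn, one_smul, ← hu₁, ← hu₂, curryLeft_wedgeOne_zero,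
    curryLeft_wedgeOne_zero, ← zeta01_dual_add J hJ1 hJ, ← hu₁, ← hu₂]
  module

/-- **Top degree** (only `σ_∂̄ σ_∂̄*'`): for a complex `n`-form `γ` (`k + 1 = n`),
`ξ^{0,1} ∧ ⋆_ℂ(ξ^{1,0} ∧ ⋆_ℂ γ) = ½ ‖ξ♯‖² γ` (forms of degree `n + 1` vanish). [cite: WarnerGTM94, 6.35] -/
theorem wedge_star_wedge_star_top (hn : Even n) (J : V →L[ℝ] V) (hJ1 : ∀ v, J (J v) = -v)
    (hJ : ∀ u v, ⟪J u, v⟫ = -⟪u, J v⟫) (ξ : V →L[ℝ] ℝ) {k : ℕ}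
    (h₁ : (k + 1) + 0 = n) (h₂ : (0 + 1) + k = n) (γ : V [⋀^Fin (k + 1)]→L[ℝ] ℂ) :
    wedgeOne (zeta01 J ξ) (⋆ℂ[o, h₂] (wedgeOne (zeta10 J ξ) (⋆ℂ[o, h₁] γ))) =
      ((2⁻¹ * ‖(InnerProductSpace.toDual ℝ V).symm ξ‖ ^ 2 : ℝ) : ℂ) • γ := by
  set u₁ : V := (InnerProductSpace.toDual ℝ V).symm (reCLM.comp (zeta10 J ξ)) with hu₁
  set u₂ : V := (InnerProductSpace.toDual ℝ V).symm (imCLM.comp (zeta10 J ξ)) with hu₂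
  -- `ξ^{0,1} ∧ γ` is an `(n+1)`-form, hence `0`
  have h0 : wedgeOne (zeta01 J ξ) γ = 0 :=
    continuousAlternatingMap_eq_zero_of_finrank_lt (n := n) (wedgeOne (zeta01 J ξ) γ) (by omega)
  have hw : ∀ w : V, wedgeOne (zeta01 J ξ) (γ.curryLeft w) = zeta01 J ξ w • γ := fun w ↦ by
    have := curryLeft_wedgeOne (zeta01 J ξ) γ w
    rw [h0, ← curryLeftL_apply (𝕜' := ℂ), _root_.map_zero] at this
    exact (sub_eq_zero.1 this.symm).symm
  rw [cHodgeStar_wedgeOne_cHodgeStar o h₁ h₂ (zeta10 J ξ) γ, neg_one_pow_mul_eq_one_of_even h₁ hn, one_smul,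
    ← hu₁, ← hu₂, wedgeOne_add, wedgeOne_smul, hw u₁, hw u₂, ← zeta01_dual_add J hJ1 hJ, ← hu₁, ← hu₂]
  module

end Operator

end Literature.Geometry.Kaehler
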